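import Summits.Parity.GeneralizedHardyLittlewood.Theorems.PrimeLevelFamEdgeMomentsBeyondDiagonalLayersSharpFlat
import Literature.NumberTheory.Sieve.DivisorBound
import HarnessLib

/-!
# Route `PrimeLevelFamEdge`, crux K_A `MomentsBeyondDiagonal` (stmt-Parity-20007), line «petersson_layers» v4:
# the CLASS SUM — `Σ_{s ≤ X, s ∣ c^∞} s^{−σ} ≪_{σ,ε} c^{ε}` (assembly step E5a)

The sharp classes `(s₁,t₁,s₂,t₂)` of `…LayersClassSplit` are indexed by `c`-factored numbers (`s ∣ c^∞`).  The per-class bounds of the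
line decay like `s₁^{−1/2}s₂^{−1/2}t₁^{−1/6}t₂^{−1/2}` relative to the generic class (census CENSUS-leafhand2-g2 on the crux item), so
the class sum is controlled by
* `sum_rpow_neg_factored_le_prod`: `Σ_{s ≤ X, s ∣ c^∞} s^{−σ} ≤ Π_{p ∣ c} (1 − p^{−σ})⁻¹` (`σ > 0`; Euler product over `c`-factored numbers,
  `BombieriSieve.sum_le_prod_tsum_of_factored` + `RankinComposed.hasSum_powWt_prime_pow`);
* `prod_primeFactors_inv_le_pow`: `Π_{p ∣ c} (1 − p^{−σ})⁻¹ ≤ ((1 − 2^{−σ})⁻¹)^{ω(c)}`;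
* `two_pow_card_primeFactors_le`: `2^{ω(c)} ≤ τ(c)` (real form); with the divisor bound
  (`Literature.NumberTheory.Sieve.exists_card_divisors_le_mul_rpow`):
* **`sum_rpow_neg_sixth_factored_le`**: for every `ε > 0` there is `C` with `Σ_{s ≤ X, s ∣ c^∞} s^{−1/6} ≤ C · c^{ε}` for all `c ≥ 1`, `X`
  (`(1 − 2^{−1/6})⁻¹ ≤ 16 = 2⁴`, so the product is `≤ τ(c)⁴`).
Proof only (def-free helper); no form is bounded here; K_A NOT proved; nothing about Landau–Siegel zeros.
-/

noncomputable section

open Finset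
open Literature.NumberTheory.Sieve

namespace Summit.Parity.GeneralizedHardyLittlewood.Theorems.MomentsBeyondDiagonal.Layers

/-- **Euler product bound for the class sum**: `Σ_{1 ≤ s ≤ X, s ∣ c^∞} s^{−σ} ≤ Π_{p ∣ c}(1 − p^{−σ})⁻¹` (`σ > 0`). [folklore] -/
theorem sum_rpow_neg_factored_le_prod (c : ℕ) {σ : ℝ} (hσ : 0 < σ) (X : ℕ) :
    ∑ s ∈ (Icc 1 X).filter (fun s ↦ s ∈ Nat.factoredNumbers c.primeFactors), ((s : ℝ)) ^ (-σ) ≤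
      ∏ p ∈ c.primeFactors, (1 - (p : ℝ) ^ (-σ))⁻¹ := by
  have hS : ∀ p ∈ c.primeFactors, p.Prime := fun p hp ↦ Nat.prime_of_mem_primeFactors hp
  have h := BombieriSieve.sum_le_prod_tsum_of_factored (h := RankinComposed.powWt σ) (RankinComposed.powWt_one σ)
    (fun {m n} _ ↦ RankinComposed.powWt_mul σ m n) (RankinComposed.powWt_nonneg σ)
    (fun {p} hp ↦ (RankinComposed.hasSum_powWt_prime_pow hp.two_le hσ).1.of_norm) hS
    (D := (Icc 1 X).filter (fun s ↦ s ∈ Nat.factoredNumbers c.primeFactors)) (fun d hd ↦ (mem_filter.mp hd).2)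
  have e : ∀ s : ℕ, RankinComposed.powWt σ s = ((s : ℝ)) ^ (-σ) := fun s ↦ rfl
  simp only [e] at h
  refine h.trans_eq (Finset.prod_congr rfl fun p hp ↦ ?_)
  have h2 := (RankinComposed.hasSum_powWt_prime_pow (hS p hp).two_le hσ).2
  simp only [e] at h2
  exact h2

/-- Each local factor is at most the one at `p = 2`: `Π_{p ∣ c}(1 − p^{−σ})⁻¹ ≤ ((1 − 2^{−σ})⁻¹)^{ω(c)}` (`σ > 0`). [folklore] -/
theorem prod_primeFactors_inv_le_pow (c : ℕ) {σ : ℝ} (hσ : 0 < σ) :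
    ∏ p ∈ c.primeFactors, (1 - (p : ℝ) ^ (-σ))⁻¹ ≤ ((1 - (2 : ℝ) ^ (-σ))⁻¹) ^ c.primeFactors.card := by
  rw [← prod_const]
  have h2 : (2 : ℝ) ^ (-σ) < 1 := Real.rpow_lt_one_of_one_lt_of_neg (by norm_num) (by linarith)
  refine prod_le_prod (fun p hp ↦ ?_) (fun p hp ↦ ?_)
  · have hp2 : (2 : ℝ) ≤ p := by exact_mod_cast (Nat.prime_of_mem_primeFactors hp).two_le
    have : (p : ℝ) ^ (-σ) ≤ (2 : ℝ) ^ (-σ) := Real.rpow_le_rpow_of_nonpos (by norm_num) hp2 (by linarith)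
    exact inv_nonneg.mpr (by linarith)
  · have hp2 : (2 : ℝ) ≤ p := by exact_mod_cast (Nat.prime_of_mem_primeFactors hp).two_le
    have hle : (p : ℝ) ^ (-σ) ≤ (2 : ℝ) ^ (-σ) := Real.rpow_le_rpow_of_nonpos (by norm_num) hp2 (by linarith)
    exact inv_anti₀ (by linarith) (by linarith)

/-- `2^{ω(c)} ≤ τ(c)` for `c ≥ 1` (every prime factor contributes a factor `≥ 2` to `τ(c) = Π(v_p(c)+1)`), real form. [folklore] -/
theorem two_pow_card_primeFactors_le {c : ℕ} (hc : c ≠ 0) : (2 : ℝ) ^ c.primeFactors.card ≤ (#c.divisors : ℝ) := by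
  have h : 2 ^ c.primeFactors.card ≤ #c.divisors := by
    rw [Nat.card_divisors hc, ← prod_const]
    refine prod_le_prod' fun p hp ↦ ?_
    have : 0 < c.factorization p :=
      Nat.Prime.factorization_pos_of_dvd (Nat.prime_of_mem_primeFactors hp) hc (Nat.dvd_of_mem_primeFactors hp)
    omega
  exact_mod_cast h

/-- `(1 − 2^{−1/6})⁻¹ ≤ 16` (`2^{−1/6} ≤ 15/16` since `(15/16)⁶ ≥ 1/2`). [folklore] -/
theorem inv_one_sub_two_rpow_neg_sixth_le : (1 - (2 : ℝ) ^ (-(1 / 6 : ℝ)))⁻¹ ≤ 16 := by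
  have hx : (2 : ℝ) ^ (-(1 / 6 : ℝ)) ≤ 15 / 16 := by
    have h6 : ((2 : ℝ) ^ (-(1 / 6 : ℝ))) ^ (6 : ℕ) = 1 / 2 := by
      rw [← Real.rpow_natCast, ← Real.rpow_mul (by norm_num)]; norm_num
    have h0 : 0 ≤ (2 : ℝ) ^ (-(1 / 6 : ℝ)) := by positivity
    by_contra hlt
    push Not at hlt
    have := pow_lt_pow_left₀ hlt (by norm_num) (by norm_num : (6 : ℕ) ≠ 0)
    rw [h6] at this
    norm_num at this
  rw [inv_le_comm₀ (by linarith) (by norm_num)]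
  linarith

/-- **The class sum is sub-power**: for every `ε > 0` there is `C ≥ 0` with `Σ_{1 ≤ s ≤ X, s ∣ c^∞} s^{−1/6} ≤ C · c^{ε}` for all
`c ≥ 1` and all `X`. [folklore] -/
theorem sum_rpow_neg_sixth_factored_le {ε : ℝ} (hε : 0 < ε) :
    ∃ C : ℝ, 0 ≤ C ∧ ∀ (c : ℕ), c ≠ 0 → ∀ X : ℕ,
      ∑ s ∈ (Icc 1 X).filter (fun s ↦ s ∈ Nat.factoredNumbers c.primeFactors), ((s : ℝ)) ^ (-(1 / 6 : ℝ)) ≤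
        C * (c : ℝ) ^ ε := by
  obtain ⟨C₁, hC₁1, hC₁⟩ := exists_card_divisors_le_mul_rpow (ε := ε / 4) (by positivity)
  refine ⟨C₁ ^ 4, by positivity, fun c hc X ↦ ?_⟩
  have hc0 : (0 : ℝ) < c := by exact_mod_cast Nat.pos_of_ne_zero hc
  have h1 := sum_rpow_neg_factored_le_prod c (σ := 1 / 6) (by norm_num) X
  have h2 := prod_primeFactors_inv_le_pow c (σ := 1 / 6) (by norm_num)
  have hA0 : 0 ≤ (1 - (2 : ℝ) ^ (-(1 / 6 : ℝ)))⁻¹ := by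
    have : (2 : ℝ) ^ (-(1 / 6 : ℝ)) < 1 := Real.rpow_lt_one_of_one_lt_of_neg (by norm_num) (by norm_num)
    exact inv_nonneg.mpr (by linarith)
  have h3 : ((1 - (2 : ℝ) ^ (-(1 / 6 : ℝ)))⁻¹) ^ c.primeFactors.card ≤ (16 : ℝ) ^ c.primeFactors.card :=
    pow_le_pow_left₀ hA0 inv_one_sub_two_rpow_neg_sixth_le _
  have h4 : (16 : ℝ) ^ c.primeFactors.card ≤ (#c.divisors : ℝ) ^ 4 := by
    rw [show (16 : ℝ) = 2 ^ 4 by norm_num, ← pow_mul, mul_comm, pow_mul]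
    exact pow_le_pow_left₀ (by positivity) (two_pow_card_primeFactors_le hc) 4
  have h5 : (#c.divisors : ℝ) ^ 4 ≤ (C₁ * (c : ℝ) ^ (ε / 4)) ^ 4 := pow_le_pow_left₀ (Nat.cast_nonneg _) (hC₁ c hc) 4
  have h6 : (C₁ * (c : ℝ) ^ (ε / 4)) ^ 4 = C₁ ^ 4 * (c : ℝ) ^ ε := by
    rw [mul_pow, ← Real.rpow_natCast ((c : ℝ) ^ (ε / 4)) 4, ← Real.rpow_mul hc0.le]
    norm_num
  calc _ ≤ _ := h1
    _ ≤ _ := h2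
    _ ≤ _ := h3
    _ ≤ _ := h4
    _ ≤ _ := h5
    _ = _ := h6

end Summit.Parity.GeneralizedHardyLittlewood.Theorems.MomentsBeyondDiagonal.Layers

end
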